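import Literature.NumberTheory.Irrationality.Zudilin2014.FirstTaleNewton

/-!
# Zudilin 2014, first tale: the rational function `R(a,b;t)` over `ℂ` in partial-fraction + Newton form

[Zudilin2014ZetaTwo] W. Zudilin, *Two hypergeometric tales and a new irrationality measure of ζ(2)*,
Ann. Math. Qué. 38 (2014), arXiv:1310.1526, Section 3, eq. (P1)–(P3).

For admissible `a b` and any field extension — here `ℂ`, where the line integrals of Proposition 1 live:
* `RC a b s := Π(a,b) · num(s)/den(s)` — `R(a,b;s)` as a complex function (`aeval` of the tree's `num`, `den`; `0` at the poles);
* **`RC_shift_eq`**: for every `t : ℂ` off the poles,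
  `R(t − a₂*) = Σ_{k=a₄}^{b₄−1} C_k/(t − a₂* + k) + Σ_{ℓ=0}^{d} A_ℓ · (t−1)(t−2)⋯(t−ℓ)/ℓ!`
  with the tree's `C_k = coefC a b k`, `A_ℓ = coefA a b ℓ` (cast `ℚ → ℂ`) — eq. (P1) with (P3) substituted, the integrand of (P4).
This is the parameter-free form of the cell's `Zeta5Search/TwoTaleP15LineRepAlgebra.ratRC_shift_eq` (pub-zeta5; any rung of the
two-tale ladder can instantiate it).  HONEST FRAMING: systematic search; no irrationality claim unless certified.
-/

noncomputable section

open Polynomial Finset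

namespace Literature.NumberTheory.Irrationality.Zudilin2014

variable {a b : Fin 4 → ℤ}

/-- **`R(a,b;s)` over `ℂ`**: `Π(a,b) · num(s) / den(s)` (junk value `0` at the poles `s = −k`).
[cite: Zudilin2014ZetaTwo, Section 3, eq. (gc)] -/
def RC (a b : Fin 4 → ℤ) (s : ℂ) : ℂ := ((Pi a b : ℚ) : ℂ) * aeval s (num a b) / aeval s (den a b)

/-- `aeval s (block lo hi) = ∏_{i ∈ [lo,hi)} (s + i)` over `ℂ`. [cite: Zudilin2014ZetaTwo, Section 3, eq. (gc)] -/
theorem aeval_block_complex (lo hi : ℤ) (s : ℂ) : aeval s (block lo hi) = ∏ i ∈ Ico lo hi, (s + (i : ℂ)) := by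
  unfold block
  rw [map_prod]
  refine prod_congr rfl fun i _ => ?_
  simp

/-- `aeval t (P_ℓ) = (∏_{j<ℓ} (t − 1 − j))/ℓ!` over `ℂ`. [cite: Zudilin2014ZetaTwo, Lemma 1 (the polynomials P_ℓ)] -/
theorem aeval_newtonP_complex (ℓ : ℕ) (t : ℂ) :
    aeval t (newtonP ℓ) = (∏ j ∈ range ℓ, (t - 1 - j)) / (ℓ.factorial : ℂ) := by
  unfold newtonP
  rw [map_mul, aeval_C, aeval_comp, map_sub, aeval_X, aeval_C, aeval_def, ← eval_map, descPochhammer_map,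
    descPochhammer_eval_eq_prod_range]
  simp [div_eq_inv_mul]

/-- **Eq. (P1) with (P3) over `ℂ`** [cite: Zudilin2014ZetaTwo, Section 3, eq. (P1)–(P3)]: for `t` off the poles,
`R(t − a₂*) = Σ_{k ∈ [a₄,b₄)} C_k/(t − a₂* + k) + Σ_{ℓ ≤ d} A_ℓ (t−1)⋯(t−ℓ)/ℓ!`. -/
theorem RC_shift_eq (h : Admissible a b) (t : ℂ)
    (ht : ∀ k ∈ Ico (a 3) (b 3), t - (a2star a : ℂ) + (k : ℂ) ≠ 0) :
    RC a b (t - (a2star a : ℂ)) =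
      ∑ k ∈ Ico (a 3) (b 3), ((coefC a b k : ℚ) : ℂ) / (t - (a2star a : ℂ) + k)
        + ∑ ℓ ∈ range (dExp a b + 1), ((coefA a b ℓ : ℚ) : ℂ) * ((∏ j ∈ range ℓ, (t - 1 - j)) / (ℓ.factorial : ℂ)) := by
  set s : ℂ := t - (a2star a : ℂ) with hs
  have hid := congrArg (aeval s) (Pi_mul_num_eq h)
  simp only [map_mul, map_add, map_sum, aeval_C, eq_ratCast] at hid
  have hden_fac : ∀ k ∈ Ico (a 3) (b 3), aeval s (den a b) = (s + k) * aeval s (denErase a b k) := by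
    intro k hk
    rw [den_eq_mul_denErase hk, map_mul, map_add, aeval_X, aeval_C]
    simp
  have hden : aeval s (den a b) ≠ 0 := by
    unfold den
    rw [aeval_block_complex]
    exact prod_ne_zero_iff.2 fun k hk => ht k hk
  have hR : RC a b s = aeval s (polyP a b) + ∑ k ∈ Ico (a 3) (b 3), ((coefC a b k : ℚ) : ℂ) / (s + k) := by
    unfold RC
    rw [div_eq_iff hden, hid, add_mul, sum_mul]
    congr 1
    refine sum_congr rfl fun k hk => ?_
    rw [hden_fac k hk]
    have hsk : s + k ≠ 0 := ht k hk
    field_simp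
  have hP : aeval s (polyP a b) =
      ∑ ℓ ∈ range (dExp a b + 1), ((coefA a b ℓ : ℚ) : ℂ) * ((∏ j ∈ range ℓ, (t - 1 - j)) / (ℓ.factorial : ℂ)) := by
    have hcomp : aeval s (polyP a b) = aeval t ((polyP a b).comp (X - C (a2star a : ℚ))) := by
      rw [aeval_comp, map_sub, aeval_X, aeval_C]
      congr 1
    rw [hcomp, polyP_newton h, map_sum]
    refine sum_congr rfl fun ℓ _ => ?_
    rw [map_mul, aeval_C, aeval_newtonP_complex]
    simp
  rw [hR, hP, add_comm]

end Literature.NumberTheory.Irrationality.Zudilin2014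

end
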